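import Summits.CriticalPhenomena.PercolationContinuityZ3.Theorems.PercNearOneGluingNoHeavyLowerTailSahiThreeCopySliceLaw
import Summits.CriticalPhenomena.PercolationContinuityZ3.Theorems.PercNearOneGluingNoHeavyLowerTailSahiThreeCopyPairHalfAnd

/-!
# `NoHeavyLowerTail` (crux stmt-CriticalPhenomena-4575), Sahi programme: **THE SLICE LAW HOLDS WHEN ONE SLOT IS AN AND-LITERAL**

Support file (Sahi cell, seat `prim-sahi-p1`, generation 56; `--supports stmt-CriticalPhenomena-4575`); companion of `…SahiThreeCopySliceLaw`
and `…SahiThreeCopyPairHalfAnd`.  Pure proofs; no `sorry`, standard axioms (the import of `…PairHalfAnd` is computational only through its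
own imports; nothing computational is used here).

The conjectured slice law (SC) `2·c_b(F¹,G¹,H¹) ≤ c_{(2,b)}(F,G,H)` (`SliceLaw`) is a THEOREM whenever one of the three functions is an
AND-literal in the sliced coordinate, `F = f ∧ x₀`, with `G, H` ARBITRARY nonnegative monotone functions on the bigger cube and NO hypothesis
on the pair `(f, G¹)`: by the exact identity of `…PairHalfAnd`,
`c_{(2,b)}(f∧x₀, G, H) − 2c_b(f,G¹,H¹) = N(f;δ·H¹;1) + N(f;G⁰η;1) + [N(fH¹;1;δ) − N(f;H¹;δ)] + [N(fG¹;1;η) − N(f;G¹;η)] ≥ 0`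
(`δ = G¹ − G⁰`, `η = H¹ − H⁰`; two positivity terms and two three-copy Harris gaps with non-monotone spectators).  So these triples lie ON or
above the facet `c₂ = 2c₃` of the slice cone (memo FROM-prim-sahi-p1-gen56 §2bis), which is how the facet is attained.  [this work]
-/

namespace Summit.CriticalPhenomena.PercolationContinuityZ3.Theorems.SahiThreeCopy

open Finset Function Literature.Combinatorics.Sahi2008
open scoped BigOperators

noncomputable section

variable {d : ℕ}

/-- ★ **(SC) for an AND-literal first slot, unconditionally**: `2·c_b(f, G¹, H¹) ≤ c_{(2,b)}(f ∧ x₀, G, H)` for `f ≥ 0` monotone on the old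
coordinates and ARBITRARY nonnegative monotone `G, H` on `{0,1}^{d+1}`. [this work] -/
theorem sliceLaw_andAdj (b : Fin d → ℕ) {f : Pt d → ℝ} (hf : ∀ x, 0 ≤ f x) (hfm : Monotone f)
    {G : Pt (d + 1) → ℝ} (hG : ∀ w, 0 ≤ G w) (hGm : Monotone G) {H : Pt (d + 1) → ℝ} (hH : ∀ w, 0 ≤ H w) (hHm : Monotone H) :
    2 * tc b f (sec G true) (sec H true) ≤ tc (Fin.cons 2 b : Fin (d + 1) → ℕ) (andAdj true f) G H := by
  have hG0n : ∀ x, 0 ≤ (sec G false) x := sec_nonneg hG false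
  have hG1n : ∀ x, 0 ≤ (sec G true) x := sec_nonneg hG true
  have hG1m : Monotone (sec G true) := sec_monotone hGm true
  have hδ : ∀ x, 0 ≤ ((sec G true) - (sec G false)) x := fun x => sub_nonneg.2 (sec_false_le_sec_true hGm x)
  have hH1n : ∀ x, 0 ≤ (sec H true) x := sec_nonneg hH true
  have hH1m : Monotone (sec H true) := sec_monotone hHm true
  have hη : ∀ x, 0 ≤ ((sec H true) - (sec H false)) x := fun x => sub_nonneg.2 (sec_false_le_sec_true hHm x)
  have one_nn : ∀ x : Pt d, (0 : ℝ) ≤ (1 : Pt d → ℝ) x := fun _ => zero_le_one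
  have P1 : 0 ≤ N3 b f ((sec G true - sec G false) * sec H true) 1 :=
    N3_nonneg b hf (fun x => mul_nonneg (hδ x) (hH1n x)) one_nn
  have P2 : 0 ≤ N3 b f (sec G false * (sec H true - sec H false)) 1 :=
    N3_nonneg b hf (fun x => mul_nonneg (hG0n x) (hη x)) one_nn
  have A1 : N3 b f (sec H true) (sec G true - sec G false) ≤ N3 b (f * sec H true) 1 (sec G true - sec G false) :=
    N3_le_N3_mul d b f (sec H true) (sec G true - sec G false) hf hfm hH1n hH1m hδ
  have A2 : N3 b f (sec G true) (sec H true - sec H false) ≤ N3 b (f * sec G true) 1 (sec H true - sec H false) :=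
    N3_le_N3_mul d b f (sec G true) (sec H true - sec H false) hf hfm hG1n hG1m hη
  have e1 : N3 b f (sec H true) (sec G true) = N3 b f (sec G true) (sec H true) := N3_comm23 b f (sec H true) (sec G true)
  have e2 : N3 b f (sec H true) (sec G false) = N3 b f (sec G false) (sec H true) := N3_comm23 b f (sec H true) (sec G false)
  have e3 : N3 b (f * sec H true) 1 (sec G true) = N3 b (sec G true) (f * sec H true) 1 := by rw [N3_comm13, N3_comm23]
  have e4 : N3 b (f * sec H true) 1 (sec G false) = N3 b (sec G false) (f * sec H true) 1 := by rw [N3_comm13, N3_comm23]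
  have e5 : N3 b (f * sec G true) 1 (sec H true) = N3 b (sec H true) (f * sec G true) 1 := by rw [N3_comm13, N3_comm23]
  have e6 : N3 b (f * sec G true) 1 (sec H false) = N3 b (sec H false) (f * sec G true) 1 := by rw [N3_comm13, N3_comm23]
  simp only [mul_sub, sub_mul, N3_sub_mid, N3_sub_right] at P1 P2 A1 A2
  rw [tc_cons_two]
  simp only [sec_andAdj_true_true, sec_andAdj_true_false, tc_zero_left, sub_zero, zero_mul, N3_zero_left, mul_zero,
    sub_zero, zero_add]
  unfold tc
  simp only [mul_sub, sub_mul, N3_sub_left, N3_sub_mid]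
  linarith [P1, P2, A1, A2, e1, e2, e3, e4, e5, e6]

/-- The same with the AND-literal in the SECOND slot (by the symmetry of `c_b`). [this work] -/
theorem sliceLaw_andAdj_mid (b : Fin d → ℕ) {g : Pt d → ℝ} (hg : ∀ x, 0 ≤ g x) (hgm : Monotone g)
    {F : Pt (d + 1) → ℝ} (hF : ∀ w, 0 ≤ F w) (hFm : Monotone F) {H : Pt (d + 1) → ℝ} (hH : ∀ w, 0 ≤ H w) (hHm : Monotone H) :
    2 * tc b (sec F true) g (sec H true) ≤ tc (Fin.cons 2 b : Fin (d + 1) → ℕ) F (andAdj true g) H := by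
  rw [tc_comm12 b, tc_comm12 (Fin.cons 2 b : Fin (d + 1) → ℕ)]
  exact sliceLaw_andAdj b hg hgm hF hFm hH hHm

/-- And in the THIRD slot. [this work] -/
theorem sliceLaw_andAdj_right (b : Fin d → ℕ) {h : Pt d → ℝ} (hh : ∀ x, 0 ≤ h x) (hhm : Monotone h)
    {F : Pt (d + 1) → ℝ} (hF : ∀ w, 0 ≤ F w) (hFm : Monotone F) {G : Pt (d + 1) → ℝ} (hG : ∀ w, 0 ≤ G w) (hGm : Monotone G) :
    2 * tc b (sec F true) (sec G true) h ≤ tc (Fin.cons 2 b : Fin (d + 1) → ℕ) F G (andAdj true h) := by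
  rw [tc_comm13 b, tc_comm13 (Fin.cons 2 b : Fin (d + 1) → ℕ)]
  exact sliceLaw_andAdj b hh hhm hG hGm hF hFm

end

end Summit.CriticalPhenomena.PercolationContinuityZ3.Theorems.SahiThreeCopy
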